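import Mathlib
import Summits.QuantumFields.YangMills.Theorems.DirichletWindowAxialLogConvexityTorus
import Summits.QuantumFields.YangMills.Theorems.EquipartitionCriticalityRPProbeCriticalityTorusHankel
import Summits.QuantumFields.YangMills.Theorems.FradkinShenkerFlowClusteringToYangMillsStubReconstructibleGeometry
import HarnessLib

/-!
# `CriticalContinuumLimit` — line `Sketch`, stub `stub_thetaCorrRP`, part 1/2: reflection
# positivity for the slab action density on the odd torus

Support file for crux `stmt-QuantumFields-8762`
(`Summit.QuantumFields.YangMills.Theses.EquipartitionCriticality.CriticalContinuumLimit`), stub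
`stub_thetaCorrRP` (torus input (T-Hankel)) of line `Sketch`; this is the torus layer, the bridge to
`latticeConnectedCorr` and the registered stub itself are part 2
(`EquipartitionCriticalityCriticalContinuumLimitStubThetaCorrRP.lean`).

**Setting.** The odd torus `(ℤ/(2S+1)ℤ)⁴` with Wilson's state `μ = wilsonMeasure ρ β` (`β ≥ 0`,
`ρ` continuous), Wave 0's time reflection `Θ = GaugeConfig.timeReflect` (`θ t = 1 - t`: a bond plane
at `t = 1/2`, a site plane at `t = S + 1`), and the **slab action density**
`Q_x(U) = Σ_q Re tr ρ(U_{(x,q)})` — the six plaquettes based at the site `x` (three spatial ones in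
the slice of `x`, three temporal ones on the slab `[x₀, x₀ + 1]`); it is Wilson's action density
`actionDensity ρ` read on the torus. Along the time axis `Q_a := Q_{a e₀}`, `a ∈ ℤ/(2S+1)`, and
`c(a, b) := Cov_μ(Q_a ∘ Θ, Q_b)`.

**Content.** `Q_x` depends only on the links based in the slice `x₀` and the spatial links of the
slice `x₀ + 1` (`dependsOn_sdens`); for `1 ≤ a ≤ S` these lie in the closed positive half of the odd
torus (`slab_subset_pos`), and so do the `Θ`-images of the links of `Q_{-a}`
(`reflect_slab_subset_pos`, `dependsOn_comp_timeReflect`). Osterwalder–Seiler positivity of the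
odd torus (tree `wilsonExpectation_oddReflectionPositive`, real form
`RPProbe.integral_timeReflect_mul_self_nonneg`) in the centred Cauchy–Schwarz form of the tree
(`RPCauchySchwarz.covariance_rp_cauchySchwarz`) then gives, for `1 ≤ s, s' ≤ S`, `0 ≤ c(s, s)`,
`c(s, s')² ≤ c(s, s) c(s', s')` (from `Q_s, Q_{s'}`) and `0 ≤ c(-s, -s)`,
`c(-s', -s)² ≤ c(-s, -s) c(-s', -s')` (from `Q_{-s} ∘ Θ, Q_{-s'} ∘ Θ`); translation invariance
(`wilsonMeasure_map_torusConfigShift`, `Θ ∘ T_{te₀} = T_{-te₀} ∘ Θ`) gives `c(a, b) = c(a+t, b-t)`.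
All three are packaged in the registered sub-goal `stub_thetaCorrRP_torus`. No definitions are
introduced (the axial family `Q` enters through a characterising hypothesis `hQ`).

References: K. Osterwalder, E. Seiler, Ann. Phys. 110 (1978) 440, §2; E. Seiler, LNP 159 (1982)
Ch. 2; J. Glimm, A. Jaffe, *Quantum Physics* (1987) §6.1; J. Fröhlich, R. Israel, E. Lieb, B. Simon,
Comm. Math. Phys. 62 (1978) 1, Thm. 2.1.
-/

noncomputable section

open MeasureTheory ProbabilityTheory Filter Topology
open scoped ComplexOrder
open Literature.MathematicalPhysics.QuantumFieldTheory

namespace Summit.QuantumFields.YangMills.Theorems.CriticalContinuumLimit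

namespace ThetaCorrRP

/-! ### Geometry: slabs of the odd torus and the positive half of the mixed reflection -/

section Geometry

variable {S : ℕ}

/-- The links based in the slice `t = u` together with the spatial links of the slice `t = u + 1`
lie in the closed positive half of the odd torus `(ℤ/(2S+1)ℤ)⁴` (links based in `1 ≤ t ≤ S`,
spatial links at `t = S + 1`) whenever `1 ≤ u ≤ S`. [folklore] -/
theorem slab_subset_pos {u : ℕ} (hu1 : 1 ≤ u) (huS : u ≤ S) :
    {e : Edge 4 (2 * S + 1) | e.1 0 = (u : ZMod (2 * S + 1)) ∨
        (e.1 0 = (u : ZMod (2 * S + 1)) + 1 ∧ e.2 ≠ 0)} ⊆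
      {e : Edge 4 (2 * S + 1) | WilsonOddRP.IsOPosEdge e ∨ WilsonOddRP.IsOSharedEdge e} := by
  intro e he
  have hv1 : ((u : ℕ) : ZMod (2 * S + 1)).val = u := ZMod.val_natCast_of_lt (by omega)
  have hv2 : ((u : ZMod (2 * S + 1)) + 1).val = u + 1 := by
    rw [← Nat.cast_succ, ZMod.val_natCast_of_lt (by omega)]
  simp only [Set.mem_setOf_eq, WilsonOddRP.IsOPosEdge, WilsonOddRP.IsOSharedEdge]
  rcases he with h | ⟨h, hne⟩
  · exact Or.inl (by rw [h, hv1]; omega)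
  · rw [h, hv2]
    by_cases hu : u + 1 ≤ S
    · exact Or.inl (by omega)
    · exact Or.inr ⟨hne, by omega⟩

/-- The reflection `θ t = 1 - t` of the odd torus carries the links based in the slice `t = -u`
and the spatial links of the slice `t = -u + 1` into the closed positive half whenever
`1 ≤ u ≤ S` (temporal links at `-u` go to temporal links at `u`; spatial links at `-u`, `-u + 1`
to spatial links at `u + 1`, `u`). [folklore] -/
theorem reflect_slab_subset_pos {u : ℕ} (hu1 : 1 ≤ u) (huS : u ≤ S) :
    ∀ e ∈ {e : Edge 4 (2 * S + 1) | e.1 0 = -(u : ZMod (2 * S + 1)) ∨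
        (e.1 0 = -(u : ZMod (2 * S + 1)) + 1 ∧ e.2 ≠ 0)}, WilsonRP.edgeReflect e ∈
      {e : Edge 4 (2 * S + 1) | WilsonOddRP.IsOPosEdge e ∨ WilsonOddRP.IsOSharedEdge e} := by
  rintro ⟨y, k⟩ he
  have hv1 : ((u : ℕ) : ZMod (2 * S + 1)).val = u := ZMod.val_natCast_of_lt (by omega)
  have hv2 : ((u : ZMod (2 * S + 1)) + 1).val = u + 1 := by
    rw [← Nat.cast_succ, ZMod.val_natCast_of_lt (by omega)]
  simp only [Set.mem_setOf_eq, WilsonOddRP.IsOPosEdge, WilsonOddRP.IsOSharedEdge] at he ⊢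
  unfold WilsonRP.edgeReflect
  by_cases hk : k = 0
  · subst hk
    have hy : y 0 = -(u : ZMod (2 * S + 1)) := he.elim id fun h => absurd rfl h.2
    have ht : (Site.shift y 0).timeReflect 0 = (u : ZMod (2 * S + 1)) := by
      rw [WilsonRP.timeReflect_apply_zero, WilsonRP.shift_apply_self, hy]; ring
    simp only [↓reduceIte]
    exact Or.inl (by rw [ht, hv1]; omega)
  · simp only [hk, ↓reduceIte]
    rcases he with h | ⟨h, -⟩
    · have ht : y.timeReflect 0 = (u : ZMod (2 * S + 1)) + 1 := by
        rw [WilsonRP.timeReflect_apply_zero, h]; ring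
      rw [ht, hv2]
      by_cases hu : u + 1 ≤ S
      · exact Or.inl (by omega)
      · exact Or.inr ⟨hk, by omega⟩
    · have ht : y.timeReflect 0 = (u : ZMod (2 * S + 1)) := by
        rw [WilsonRP.timeReflect_apply_zero, h]; ring
      exact Or.inl (by rw [ht, hv1]; omega)

end Geometry

/-! ### The slab action density `Q_x = Σ_q Re tr ρ(U_{(x,q)})` -/

section Slab

variable {G : Type} [Group G] {N : ℕ} (ρ : G →* Matrix (Fin N) (Fin N) ℂ) {M : ℕ}

/-- The slab density at `x` depends only on the links based in the slice of `x` and the spatial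
links of the next slice. [folklore] -/
theorem dependsOn_sdens (x : Site 4 M) :
    DependsOn (fun U : GaugeConfig 4 M G =>
        ∑ q : {p : Fin 4 × Fin 4 // p.1 < p.2}, WilsonRP.plaqRe ρ U (x, q))
      {e : Edge 4 M | e.1 0 = x 0 ∨ (e.1 0 = x 0 + 1 ∧ e.2 ≠ 0)} := by
  intro U V hUV
  refine Finset.sum_congr rfl fun q _ => ?_
  have hq2 : q.1.2 ≠ 0 := WilsonRP.plaq_snd_ne_zero (x, q)
  refine AxialLogConvexity.dependsOn_tplaq ρ x ?_ ?_ ?_ ?_ hUV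
  · exact Or.inl rfl
  · by_cases hq1 : q.1.1 = 0
    · refine Or.inr ⟨?_, hq2⟩
      show (Site.shift x q.1.1) 0 = x 0 + 1
      rw [hq1, WilsonRP.shift_apply_self]
    · exact Or.inl (WilsonRP.shift_apply_of_ne x (Ne.symm hq1))
  · exact Or.inl (WilsonRP.shift_apply_of_ne x (Ne.symm hq2))
  · exact Or.inl rfl

/-- Composing with the time reflection `Θ` transports the dependence set through the link
reflection `edgeReflect` (`(ΘU)_e` is `U_{ϑe}` or its inverse). [folklore] -/
theorem dependsOn_comp_timeReflect {H : GaugeConfig 4 M G → ℝ} {s t : Set (Edge 4 M)}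
    (hH : DependsOn H s) (hst : ∀ e ∈ s, WilsonRP.edgeReflect e ∈ t) :
    DependsOn (fun U : GaugeConfig 4 M G => H (GaugeConfig.timeReflect U)) t := by
  refine fun U V hUV => hH fun e he => ?_
  show GaugeConfig.timeReflect U e = GaugeConfig.timeReflect V e
  rw [WilsonRP.timeReflect_apply, WilsonRP.timeReflect_apply, hUV _ (hst e he)]

/-- Translating the configuration translates the slab density. [folklore] -/
theorem sdens_torusConfigShift [MeasurableSpace G] (v x : Site 4 M) (U : GaugeConfig 4 M G) :
    ∑ q : {p : Fin 4 × Fin 4 // p.1 < p.2}, WilsonRP.plaqRe ρ (torusConfigShift v U) (x, q) =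
      ∑ q : {p : Fin 4 × Fin 4 // p.1 < p.2}, WilsonRP.plaqRe ρ U (x - v, q) :=
  Finset.sum_congr rfl fun _ _ => AxialLogConvexity.tplaq_torusConfigShift ρ v x U

end Slab

/-! ### The torus Wilson state: reflection positivity in Cauchy–Schwarz form -/

section Wilson

variable {G : Type} [Group G] [TopologicalSpace G] [IsTopologicalGroup G] [CompactSpace G]
  [MeasurableSpace G] [BorelSpace G] {N : ℕ} (ρ : G →* Matrix (Fin N) (Fin N) ℂ) {S : ℕ} {β : ℝ}

omit [CompactSpace G] in
/-- The slab density is measurable. [folklore] -/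
theorem measurable_sdens (hρ : Continuous ρ) {M : ℕ} (x : Site 4 M) :
    Measurable fun U : GaugeConfig 4 M G =>
      ∑ q : {p : Fin 4 × Fin 4 // p.1 < p.2}, WilsonRP.plaqRe ρ U (x, q) :=
  Finset.measurable_sum _ fun q _ => WilsonRP.measurable_plaqRe ρ hρ (x, q)

omit [MeasurableSpace G] [BorelSpace G] in
/-- The slab density is bounded by `6N` (`|Re tr ρ(U_p)| ≤ N` for each of the six planes). [folklore] -/
theorem abs_sdens_le (hρ : Continuous ρ) {M : ℕ} (x : Site 4 M) (U : GaugeConfig 4 M G) :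
    |∑ q : {p : Fin 4 × Fin 4 // p.1 < p.2}, WilsonRP.plaqRe ρ U (x, q)| ≤
      (Fintype.card {p : Fin 4 × Fin 4 // p.1 < p.2} : ℝ) * N :=
  calc |∑ q : {p : Fin 4 × Fin 4 // p.1 < p.2}, WilsonRP.plaqRe ρ U (x, q)|
        ≤ ∑ q : {p : Fin 4 × Fin 4 // p.1 < p.2}, |WilsonRP.plaqRe ρ U (x, q)| :=
          Finset.abs_sum_le_sum_abs _ _
    _ ≤ ∑ _q : {p : Fin 4 × Fin 4 // p.1 < p.2}, (N : ℝ) :=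
          Finset.sum_le_sum fun q _ => WilsonRP.abs_plaqRe_le ρ hρ U _
    _ = (Fintype.card {p : Fin 4 × Fin 4 // p.1 < p.2} : ℝ) * N := by
          rw [Finset.sum_const, Finset.card_univ, nsmul_eq_mul]

/-- **Centred reflection positivity with Cauchy–Schwarz** for two positive-half observables
`F, K` of the odd torus, `S ≥ 1`, `β ≥ 0` (tree `RPCauchySchwarz.covariance_rp_cauchySchwarz` over
the real form `RPProbe.integral_timeReflect_mul_self_nonneg` of `wilsonExpectation_oddReflectionPositive`;
Osterwalder–Seiler 1978 §2): `0 ≤ Cov(F∘Θ, F)` and `Cov(F∘Θ, K)² ≤ Cov(F∘Θ, F) Cov(K∘Θ, K)`. [folklore] -/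
theorem cov_rpcs (hρ : Continuous ρ) (hβ : 0 ≤ β) (hS : 1 ≤ S) {F K : GaugeConfig 4 (2 * S + 1) G → ℝ}
    (hF : Measurable F) (hK : Measurable K) (hFb : ∃ C : ℝ, ∀ U, |F U| ≤ C)
    (hKb : ∃ C : ℝ, ∀ U, |K U| ≤ C)
    (hFD : DependsOn F {e : Edge 4 (2 * S + 1) | WilsonOddRP.IsOPosEdge e ∨ WilsonOddRP.IsOSharedEdge e})
    (hKD : DependsOn K {e : Edge 4 (2 * S + 1) | WilsonOddRP.IsOPosEdge e ∨ WilsonOddRP.IsOSharedEdge e}) :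
    0 ≤ cov[fun U => F (GaugeConfig.timeReflect U), F; wilsonMeasure (d := 4) (L := 2 * S + 1) ρ β] ∧
      cov[fun U => F (GaugeConfig.timeReflect U), K; wilsonMeasure (d := 4) (L := 2 * S + 1) ρ β] ^ 2 ≤
        cov[fun U => F (GaugeConfig.timeReflect U), F; wilsonMeasure (d := 4) (L := 2 * S + 1) ρ β] *
          cov[fun U => K (GaugeConfig.timeReflect U), K; wilsonMeasure (d := 4) (L := 2 * S + 1) ρ β] := by
  haveI := isProbabilityMeasure_wilsonMeasure (d := 4) (L := 2 * S + 1) ρ hρ β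
  have h := FiniteSusceptibilityWeakCoupling.RPCauchySchwarz.covariance_rp_cauchySchwarz
    (μ := wilsonMeasure (d := 4) (L := 2 * S + 1) ρ β) WilsonRP.measurable_timeReflect
    (FiniteSusceptibilityWeakCoupling.RPCauchySchwarz.wilsonMeasure_map_timeReflect ρ hρ β)
    FiniteSusceptibilityWeakCoupling.RPCauchySchwarz.timeReflect_timeReflect
    (D := fun H => DependsOn H
      {e : Edge 4 (2 * S + 1) | WilsonOddRP.IsOPosEdge e ∨ WilsonOddRP.IsOSharedEdge e})
    (fun H hH hHb hHD =>
      EquipartitionCriticality.RPProbe.integral_timeReflect_mul_self_nonneg ρ hρ hβ hS H hH hHb hHD)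
    (fun H K t hH hK => FiniteSusceptibilityWeakCoupling.RPCauchySchwarz.dependsOn_add_mul hH hK t)
    (fun H c hH => FiniteSusceptibilityWeakCoupling.RPCauchySchwarz.dependsOn_sub_const hH c)
    hF hK hFb hKb hFD hKD
  exact ⟨h.1, h.2.2⟩

/-- The same for two observables `F, K` whose REFLECTIONS `F∘Θ, K∘Θ` live on the positive half
(`Θ` is a measure-preserving involution, so the two halves may be exchanged):
`0 ≤ Cov(F∘Θ, F)` and `Cov(K∘Θ, F)² ≤ Cov(F∘Θ, F) Cov(K∘Θ, K)`. [folklore] -/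
theorem cov_rpcs_reflected (hρ : Continuous ρ) (hβ : 0 ≤ β) (hS : 1 ≤ S)
    {F K : GaugeConfig 4 (2 * S + 1) G → ℝ} (hF : Measurable F) (hK : Measurable K)
    (hFb : ∃ C : ℝ, ∀ U, |F U| ≤ C) (hKb : ∃ C : ℝ, ∀ U, |K U| ≤ C)
    (hFD : DependsOn (fun U => F (GaugeConfig.timeReflect U))
      {e : Edge 4 (2 * S + 1) | WilsonOddRP.IsOPosEdge e ∨ WilsonOddRP.IsOSharedEdge e})
    (hKD : DependsOn (fun U => K (GaugeConfig.timeReflect U))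
      {e : Edge 4 (2 * S + 1) | WilsonOddRP.IsOPosEdge e ∨ WilsonOddRP.IsOSharedEdge e}) :
    0 ≤ cov[fun U => F (GaugeConfig.timeReflect U), F; wilsonMeasure (d := 4) (L := 2 * S + 1) ρ β] ∧
      cov[fun U => K (GaugeConfig.timeReflect U), F; wilsonMeasure (d := 4) (L := 2 * S + 1) ρ β] ^ 2 ≤
        cov[fun U => F (GaugeConfig.timeReflect U), F; wilsonMeasure (d := 4) (L := 2 * S + 1) ρ β] *
          cov[fun U => K (GaugeConfig.timeReflect U), K; wilsonMeasure (d := 4) (L := 2 * S + 1) ρ β] := by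
  obtain ⟨CF, hCF⟩ := hFb
  obtain ⟨CK, hCK⟩ := hKb
  have h := cov_rpcs ρ hρ hβ hS (F := fun U => F (GaugeConfig.timeReflect U))
    (K := fun U => K (GaugeConfig.timeReflect U)) (hF.comp WilsonRP.measurable_timeReflect)
    (hK.comp WilsonRP.measurable_timeReflect) ⟨CF, fun U => hCF _⟩ ⟨CK, fun U => hCK _⟩ hFD hKD
  simp only [FiniteSusceptibilityWeakCoupling.RPCauchySchwarz.timeReflect_timeReflect] at h
  obtain ⟨h1, h3⟩ := h
  rw [covariance_comm F] at h1
  rw [covariance_comm F, covariance_comm K, covariance_comm F] at h3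
  exact ⟨h1, h3⟩

/-! ### The axial family `Q_a = Q_{a e₀}` and the reflected covariance `c(a, b) = Cov(Q_a∘Θ, Q_b)` -/

section Axial

variable {Q : ZMod (2 * S + 1) → GaugeConfig 4 (2 * S + 1) G → ℝ}
  (hQ : ∀ (c : ZMod (2 * S + 1)) (U : GaugeConfig 4 (2 * S + 1) G), Q c U =
    ∑ q : {p : Fin 4 × Fin 4 // p.1 < p.2},
      WilsonRP.plaqRe ρ U ((Pi.single 0 c : Site 4 (2 * S + 1)), q))
include hQ

omit [CompactSpace G] in
/-- `Q_a` is measurable. [folklore] -/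
theorem measurable_axial (hρ : Continuous ρ) (c : ZMod (2 * S + 1)) : Measurable (Q c) := by
  rw [show Q c = _ from funext (hQ c)]
  exact measurable_sdens ρ hρ _

omit [MeasurableSpace G] [BorelSpace G] in
/-- `|Q_a| ≤ 6N`. [folklore] -/
theorem abs_axial_le (hρ : Continuous ρ) (c : ZMod (2 * S + 1)) (U : GaugeConfig 4 (2 * S + 1) G) :
    |Q c U| ≤ (Fintype.card {p : Fin 4 × Fin 4 // p.1 < p.2} : ℝ) * N := by
  rw [hQ]
  exact abs_sdens_le ρ hρ _ U

omit [TopologicalSpace G] [IsTopologicalGroup G] [CompactSpace G] [BorelSpace G] in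
/-- Time translations act on the axial family: `Q_a ∘ T_{te₀} = Q_{a - t}`. [folklore] -/
theorem axial_torusConfigShift (c t : ZMod (2 * S + 1)) (U : GaugeConfig 4 (2 * S + 1) G) :
    Q c (torusConfigShift (Pi.single 0 t) U) = Q (c - t) U := by
  rw [hQ, hQ, sdens_torusConfigShift, AxialLogConvexity.axis_sub_axis]

omit [TopologicalSpace G] [IsTopologicalGroup G] [CompactSpace G] [BorelSpace G] in
/-- `Q_a ∘ Θ ∘ T_{te₀} = Q_{a + t} ∘ Θ` (`Θ ∘ T_{te₀} = T_{-te₀} ∘ Θ`). [folklore] -/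
theorem axial_timeReflect_torusConfigShift (c t : ZMod (2 * S + 1))
    (U : GaugeConfig 4 (2 * S + 1) G) :
    Q c (GaugeConfig.timeReflect (torusConfigShift (Pi.single 0 t) U)) =
      Q (c + t) (GaugeConfig.timeReflect U) := by
  rw [ClusteringToYangMills.Reconstructible.timeReflect_torusConfigShift_single,
    axial_torusConfigShift ρ hQ, sub_neg_eq_add]

omit [TopologicalSpace G] [IsTopologicalGroup G] [CompactSpace G] [MeasurableSpace G] [BorelSpace G] in
/-- `Q_a`, `1 ≤ a ≤ S`, is an observable of the closed positive half. [folklore] -/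
theorem dependsOn_axial_pos {u : ℕ} (hu1 : 1 ≤ u) (huS : u ≤ S) :
    DependsOn (Q (u : ZMod (2 * S + 1)))
      {e : Edge 4 (2 * S + 1) | WilsonOddRP.IsOPosEdge e ∨ WilsonOddRP.IsOSharedEdge e} := by
  have h := dependsOn_sdens ρ (M := 2 * S + 1)
    (Pi.single 0 ((u : ℕ) : ZMod (2 * S + 1)) : Site 4 (2 * S + 1))
  simp only [Pi.single_eq_same] at h
  rw [show Q (u : ZMod (2 * S + 1)) = _ from funext (hQ _)]
  exact h.mono (slab_subset_pos hu1 huS)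

omit [TopologicalSpace G] [IsTopologicalGroup G] [CompactSpace G] [MeasurableSpace G] [BorelSpace G] in
/-- `Q_{-a} ∘ Θ`, `1 ≤ a ≤ S`, is an observable of the closed positive half. [folklore] -/
theorem dependsOn_axial_reflect_pos {u : ℕ} (hu1 : 1 ≤ u) (huS : u ≤ S) :
    DependsOn (fun U => Q (-(u : ZMod (2 * S + 1))) (GaugeConfig.timeReflect U))
      {e : Edge 4 (2 * S + 1) | WilsonOddRP.IsOPosEdge e ∨ WilsonOddRP.IsOSharedEdge e} := by
  have h := dependsOn_sdens ρ (M := 2 * S + 1)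
    (Pi.single 0 (-((u : ℕ) : ZMod (2 * S + 1))) : Site 4 (2 * S + 1))
  simp only [Pi.single_eq_same] at h
  rw [← show Q (-(u : ZMod (2 * S + 1))) = _ from funext (hQ _)] at h
  exact dependsOn_comp_timeReflect h (reflect_slab_subset_pos hu1 huS)

/-- **Translation invariance of the reflected covariance**: `c(a, b) = c(a + t, b - t)`. [folklore] -/
theorem cov_axial_shift (hρ : Continuous ρ) (a b t : ZMod (2 * S + 1)) :
    cov[fun U => Q a (GaugeConfig.timeReflect U), Q b; wilsonMeasure (d := 4) (L := 2 * S + 1) ρ β] =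
      cov[fun U => Q (a + t) (GaugeConfig.timeReflect U), Q (b - t);
        wilsonMeasure (d := 4) (L := 2 * S + 1) ρ β] := by
  have _ := hρ
  conv_lhs => rw [← wilsonMeasure_map_torusConfigShift ρ β (Pi.single 0 t : Site 4 (2 * S + 1))]
  rw [covariance_map_equiv]
  simp only [Function.comp_def, axial_timeReflect_torusConfigShift ρ hQ, axial_torusConfigShift ρ hQ]

/-- **First Hankel family**: for `1 ≤ s, s' ≤ S`, `0 ≤ c(s, s)` and `c(s, s')² ≤ c(s, s) c(s', s')`
(reflection positivity for the pencil of `Q_s - ⟨Q⟩`, `Q_{s'} - ⟨Q⟩`). [folklore] -/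
theorem axial_rpcs_pos (hρ : Continuous ρ) (hβ : 0 ≤ β) (hS : 1 ≤ S) {s s' : ℕ} (hs1 : 1 ≤ s)
    (hsS : s ≤ S) (hs1' : 1 ≤ s') (hsS' : s' ≤ S) :
    0 ≤ cov[fun U => Q s (GaugeConfig.timeReflect U), Q s; wilsonMeasure (d := 4) (L := 2 * S + 1) ρ β] ∧
      cov[fun U => Q s (GaugeConfig.timeReflect U), Q s';
          wilsonMeasure (d := 4) (L := 2 * S + 1) ρ β] ^ 2 ≤
        cov[fun U => Q s (GaugeConfig.timeReflect U), Q s; wilsonMeasure (d := 4) (L := 2 * S + 1) ρ β] *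
          cov[fun U => Q s' (GaugeConfig.timeReflect U), Q s';
            wilsonMeasure (d := 4) (L := 2 * S + 1) ρ β] :=
  cov_rpcs ρ hρ hβ hS (measurable_axial ρ hQ hρ _) (measurable_axial ρ hQ hρ _)
    ⟨_, abs_axial_le ρ hQ hρ _⟩ ⟨_, abs_axial_le ρ hQ hρ _⟩
    (dependsOn_axial_pos ρ hQ hs1 hsS) (dependsOn_axial_pos ρ hQ hs1' hsS')

/-- **Second Hankel family**: for `1 ≤ s, s' ≤ S`, `0 ≤ c(-s, -s)` and
`c(-s', -s)² ≤ c(-s, -s) c(-s', -s')` (reflection positivity for the pencil of the reflected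
observables `Q_{-s} ∘ Θ - ⟨Q⟩`, `Q_{-s'} ∘ Θ - ⟨Q⟩`). [folklore] -/
theorem axial_rpcs_neg (hρ : Continuous ρ) (hβ : 0 ≤ β) (hS : 1 ≤ S) {s s' : ℕ} (hs1 : 1 ≤ s)
    (hsS : s ≤ S) (hs1' : 1 ≤ s') (hsS' : s' ≤ S) :
    0 ≤ cov[fun U => Q (-(s : ZMod (2 * S + 1))) (GaugeConfig.timeReflect U),
        Q (-(s : ZMod (2 * S + 1))); wilsonMeasure (d := 4) (L := 2 * S + 1) ρ β] ∧
      cov[fun U => Q (-(s' : ZMod (2 * S + 1))) (GaugeConfig.timeReflect U),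
          Q (-(s : ZMod (2 * S + 1))); wilsonMeasure (d := 4) (L := 2 * S + 1) ρ β] ^ 2 ≤
        cov[fun U => Q (-(s : ZMod (2 * S + 1))) (GaugeConfig.timeReflect U),
            Q (-(s : ZMod (2 * S + 1))); wilsonMeasure (d := 4) (L := 2 * S + 1) ρ β] *
          cov[fun U => Q (-(s' : ZMod (2 * S + 1))) (GaugeConfig.timeReflect U),
            Q (-(s' : ZMod (2 * S + 1))); wilsonMeasure (d := 4) (L := 2 * S + 1) ρ β] :=
  cov_rpcs_reflected ρ hρ hβ hS (measurable_axial ρ hQ hρ _) (measurable_axial ρ hQ hρ _)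
    ⟨_, abs_axial_le ρ hQ hρ _⟩ ⟨_, abs_axial_le ρ hQ hρ _⟩
    (dependsOn_axial_reflect_pos ρ hQ hs1 hsS) (dependsOn_axial_reflect_pos ρ hQ hs1' hsS')

end Axial

end Wilson

end ThetaCorrRP

/-! ### The registered sub-goal -/

/-- **Registered sub-goal `stub_thetaCorrRP_torus` of stub `stub_thetaCorrRP`** (part 1/2: the two
Hankel positivities of the odd torus). On `(ℤ/(2S+1)ℤ)⁴`, `S ≥ 1`, at `β ≥ 0`, for continuous `ρ`,
the reflected covariance `c(a, b) = Cov_β(Q_a ∘ Θ, Q_b)` of the slab action density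
`Q_a(U) = Σ_q Re tr ρ(U_{(a e₀, q)})` (written out with Wave 0's `plaquetteHolonomy`; it is
`Σ_q WilsonRP.plaqRe ρ U (a e₀, q)` by `rfl`; `Θ` = Wave 0's `GaugeConfig.timeReflect`, `θ t = 1 - t`)
satisfies `c(a, b) = c(a + t, b - t)` (translation invariance) and, for `1 ≤ s, s' ≤ S`,
`0 ≤ c(s, s)`, `c(s, s')² ≤ c(s, s) c(s', s')`, `0 ≤ c(-s, -s)`,
`c(-s', -s)² ≤ c(-s, -s) c(-s', -s')` (Osterwalder–Seiler positivity of the mixed reflection of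
the odd torus applied to `Q_s`, resp. `Q_{-s} ∘ Θ`, which live on the closed positive half). [folklore] -/
theorem stub_thetaCorrRP_torus (G : Type) [Group G] [TopologicalSpace G] [IsTopologicalGroup G]
    [CompactSpace G] [MeasurableSpace G] [BorelSpace G] (N : ℕ) (ρ : G →* Matrix (Fin N) (Fin N) ℂ)
    (hρ : Continuous ρ) (β : ℝ) (hβ : 0 ≤ β) (S : ℕ) (hS : 1 ≤ S)
    (c : ZMod (2 * S + 1) → ZMod (2 * S + 1) → ℝ)
    (hc : ∀ a b : ZMod (2 * S + 1), c a b = ProbabilityTheory.covariance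
      (fun U => ∑ q : {p : Fin 4 × Fin 4 // p.1 < p.2}, (ρ (plaquetteHolonomy (GaugeConfig.timeReflect U)
        (Pi.single 0 a : Literature.MathematicalPhysics.QuantumFieldTheory.Site 4 (2 * S + 1))
          q.1.1 q.1.2)).trace.re)
      (fun U => ∑ q : {p : Fin 4 × Fin 4 // p.1 < p.2}, (ρ (plaquetteHolonomy U
        (Pi.single 0 b : Literature.MathematicalPhysics.QuantumFieldTheory.Site 4 (2 * S + 1))
          q.1.1 q.1.2)).trace.re)
      (wilsonMeasure (d := 4) (L := 2 * S + 1) ρ β)) :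
    (∀ a b t : ZMod (2 * S + 1), c a b = c (a + t) (b - t)) ∧
    (∀ s s' : ℕ, 1 ≤ s → s ≤ S → 1 ≤ s' → s' ≤ S → 0 ≤ c s s ∧ c s s' ^ 2 ≤ c s s * c s' s') ∧
    (∀ s s' : ℕ, 1 ≤ s → s ≤ S → 1 ≤ s' → s' ≤ S →
      0 ≤ c (-(s : ZMod (2 * S + 1))) (-(s : ZMod (2 * S + 1))) ∧
        c (-(s' : ZMod (2 * S + 1))) (-(s : ZMod (2 * S + 1))) ^ 2 ≤
          c (-(s : ZMod (2 * S + 1))) (-(s : ZMod (2 * S + 1))) *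
            c (-(s' : ZMod (2 * S + 1))) (-(s' : ZMod (2 * S + 1)))) := by
  obtain ⟨Q, hQ⟩ : ∃ Q : ZMod (2 * S + 1) → GaugeConfig 4 (2 * S + 1) G → ℝ,
      ∀ (a : ZMod (2 * S + 1)) (U : GaugeConfig 4 (2 * S + 1) G), Q a U =
        ∑ q : {p : Fin 4 × Fin 4 // p.1 < p.2},
          WilsonRP.plaqRe ρ U ((Pi.single 0 a : Site 4 (2 * S + 1)), q) := ⟨_, fun _ _ => rfl⟩
  have hc' : ∀ a b : ZMod (2 * S + 1), c a b =
      cov[fun U => Q a (GaugeConfig.timeReflect U), Q b;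
        wilsonMeasure (d := 4) (L := 2 * S + 1) ρ β] := by
    intro a b
    rw [hc, show Q b = _ from funext (hQ b)]
    simp only [hQ, WilsonRP.plaqRe]
  refine ⟨fun a b t => ?_, fun s s' hs1 hsS hs1' hsS' => ?_, fun s s' hs1 hsS hs1' hsS' => ?_⟩
  · rw [hc', hc', ThetaCorrRP.cov_axial_shift ρ hQ hρ a b t]
  · rw [hc', hc', hc']
    exact ThetaCorrRP.axial_rpcs_pos ρ hQ hρ hβ hS hs1 hsS hs1' hsS'
  · rw [hc', hc', hc']
    exact ThetaCorrRP.axial_rpcs_neg ρ hQ hρ hβ hS hs1 hsS hs1' hsS'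

end Summit.QuantumFields.YangMills.Theorems.CriticalContinuumLimit

end
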